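import Literature.NumberTheory.EllipticCurves.CastellaHsuKunduLeeLiu2025.SignedBipartiteEulerSystem
import Literature.NumberTheory.EllipticCurves.Rank1Residual.Predicates
import Literature.NumberTheory.Automorphic.BrandtEigenLine
import Literature.NumberTheory.Automorphic.BrandtXi
import HarnessLib


/-!
# Multiplicity one modulo `p` for the definite Brandt module at a level-raised elliptic eigensystem
# (Pollack–Weston 2011 Thm. 6.2 / Kim–Ota 2023 Thm. 5.5, read on eigenvectors) — named fact

Topic `NumberTheory/EllipticCurves`; namespace `Literature.NumberTheory.EllipticCurves.DefiniteMultiplicityOne`.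
ONE named fact (D-0014; a `def … : Prop`, nothing asserted, no `sorry`, no instance, no notation) — the typing
target `SpecMult1` («MULT1») of the crux workfile
`Summits/BirchSwinnertonDyer/BirchSwinnertonDyer/Cruxes/AnticyclotomicEisensteinDivisibility/Lines/admdef_bridge_spec.lean`
(LEAD `bsd-line-sbc-p1` g19/g20, crux stmt-BirchSwinnertonDyer-20727 line `admdef`, registered stub `stub_specMult1`),
stated in the tree's Brandt-module vocabulary (`Brandt.XiSetup`, `Brandt.ClassSet`, `Brandt.matrix`, `Brandt.eigenSpace`,
Pollack–Weston's `M^f` currency of `Literature/NumberTheory/Automorphic/BrandtEigenLine.lean`) with ONE hypothesis added to the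
LEAD's text (`W.HasGoodReductionAtPrime p`, i.e. print's standing `p ∤ N`).

## The print

* [PollackWeston2011] R. Pollack, T. Weston, *On anticyclotomic μ-invariants of modular forms*, Compos. Math. 147
  (2011), §2.1 (the space `M^f`; "`M^f` is free of rank one") and **Thm. 6.2**: "If `(ρ̄_f, rN₂)` satisfies hypothesis
  (CR), then `X̂_r(N₁, N₂)` [the `𝔪_f`-completed character group at `r` of the Shimura curve `X(N₁, N₂)` = the
  definite Brandt module of discriminant `rN₂` and Eichler level `N₁/r`] is free of rank one over the Hecke algebra
  `𝕋̂_0(N₁/r, rN₂)`" (proof: Wiles' and Helm's multiplicity one `dim_k J[𝔪_f] = 2`, Mazur's principle, Nakayama);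
  standing: `N = N⁺N⁻` SQUARE-FREE, `p ≥ 5`, (CR) = `ρ̄_f` surjective and ramified at the `q ∣ N⁻` with `q ≡ ±1 (p)`.
* [KimOta2023] C.-H. Kim, K. Ota, Res. Math. Sci. 10 (2023) = arXiv:1905.02926, §5.1 (`S^{N⁻}_k(N, 𝒪)` = `𝒪`-valued
  functions on `B^×\B̂^×/R̂^×`, `B` definite of discriminant `N⁻`, `R` Eichler of level `N⁺`, modulo constants),
  Assumption 5.3 (CR⁺) and **Thm. 5.5**: "Under Assumption (CR⁺), `S^{N⁻}_k(N, 𝒪)_𝔪` is a free `𝕋^{N⁻}(N)_𝔪`-module of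
  rank one. Proof. See [Chida–Hsieh 2018]."; Remark 5.6 (the cited proof is written for the ordinary deformation
  condition; "the replacement … by the low weight crystalline deformation condition does not affect any of result");
  standing Assumption 1.4: `ρ̄` odd, absolutely irreducible, (FL) `2 ≤ k ≤ p − 1`, `p ∤ N`, (TW) `ρ̄|_{ℚ(√p*)}`
  absolutely irreducible; (CR⁺): `p ∤ N`, `p, N⁺, N⁻` pairwise coprime, `N⁻` square-free, `q ∣ N⁻ ∧ q ≡ ±1 (p) ⇒
  q ∣ N(ρ̄)`, `q ∥ N⁺ ∧ q ≡ 1 (p) ⇒ q ∣ N(ρ̄)`, `(N(ρ̄), N/N(ρ̄)) = 1`.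
* [BertoliniDarmon2005] M. Bertolini, H. Darmon, Ann. of Math. 162 (2005), **Thm. 5.15** hypothesis (2) ("the
  completion `X_m(X_{N⁺m, N⁻/m})_{𝔪_f}` … is free of rank 1 over the completed Hecke algebra `𝕋_{𝔪_f}`") and its use on
  p. 56: "By multiplicity one, this function is equal modulo `pⁿ` to the eigenform `f` … (up to multiplication by an
  element of `(ℤ/pⁿℤ)^×`)" — the EIGENFUNCTION-UNIQUENESS form typed here (`n = 1`).
* [CastellaEtAl2025] §7.2 Remark 7.3 and Thm. 7.4 (the level-raised `m`-new eigensystem on the definite algebra of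
  discriminant `m`, `m ∈ 𝒩^def`, under Condition CR) — the consumer's setting (`N⁻ = 1`, so here `N⁺ = N_E`, `N⁻ = m`).

## The typed statement (READING of the print — documented deltas, never silently stronger)

For `E = W/ℚ` (globally minimal, conductor `N`), `p ≥ 5` of GOOD reduction (print: `p ∤ N`), `ρ̄_{E,p}` onto (print: (CR)/(TW),
absolute irreducibility), `K` imaginary quadratic with every `ℓ ∣ N` split (consumer's `N⁻ = 1`), `E[p]` RAMIFIED at every
`q ∣ N` (⇒ `N(ρ̄) = N` for `p ≥ 5`, hence (CR⁺) for the pair `(N⁺, N⁻) = (N, m)`), every `m ∈ 𝒩₁^def` (square-free product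
of an odd number of BD-admissible primes: `q ∤ pN`, `q` inert, `q ≢ ±1 (p)`) and every definite set-up `S` of type `(N, m)`
(`Brandt.XiSetup N m`: `disc D = m`, Eichler level `N`): ANY TWO mod-`p` common eigenvectors of the Brandt matrices `T_ℓ`
(`ℓ ∤ Nm` prime; `Matrix.mulVec` convention of `Brandt.eigenSpace`) for the eigenvalues `a_ℓ(E)` are PROPORTIONAL when the first
is non-zero — `dim_{𝔽_p} (𝔽_p^{Cls O})[𝔪^{an}] ≤ 1`.
READINGS (how print ⇒ this sentence; recorded, not proved here): (R1) SOCLE vs COSOCLE (typer flag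
`mult-one-socle-vs-cosocle`): print gives `S_𝔪 ≅ 𝕋_𝔪` (cosocle `S/𝔪S` one-dimensional); the weighted pairing
`⟨φ, ψ⟩ = Σ_i w_i φ_i ψ_i` (PW11 §2.1 / KO23 (5.1); `w_i ∣ 12` units for `p ≥ 5`) is perfect and Hecke-self-adjoint
(`Brandt.matrix` with `mulVec`, tree docstring of `BrandtXi.lean`), so `𝕋_𝔪` is Gorenstein, `𝕋_𝔪/p` is a Gorenstein Artinian
local ring with residue field `𝔽_p` (all eigenvalues `a_ℓ(E)`, `±1`, `0` lie in `𝔽_p`), and `(S ⊗ 𝔽_p)[𝔪]` = its socle is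
ONE-dimensional over `𝔽_p`; (R2) ANEMIC vs FULL (flag `anemic-vs-full`): `Brandt.eigenSpace` constrains only `T_ℓ`, `ℓ ∤ Nm`;
on `S_𝔪` the operators at `q ∣ Nm` act by FORCED scalars — at `q ∥ N`: `𝔪` is `q`-new (an eigensystem of level prime to `q`
is unramified at `q`, `ρ̄` is not), `U_q² = 1` on the `q`-new part and `U_q ≡ a_q(E) = ±1 (mod 𝔪)` is forced by the
non-split `ρ̄|_{G_q}` (unique unramified quotient character), so `U_q = a_q(E)` on `S_𝔪`; at `q² ∣ N`: every `𝔪`-congruent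
eigenform has exact `q`-conductor `q^{v_q(N)}` (`N(ρ̄)_q = N_q` for `p ≥ 5`), so `U_q = a_q = 0` on `S_𝔪 ⊗ ℚ̄_p ⊇ S_𝔪`; at
`q ∣ m` (ramified in `D`): the involution has the sign `ε_q` forced by admissibility (`q ≢ ±1`); hence `𝔪` is the only
maximal ideal above `𝔪^{an}` in the support of `S` and `(S ⊗ 𝔽_p)[𝔪^{an}] = (S ⊗ 𝔽_p)[𝔪]`; (R3) the Eisenstein line
(eigenvalues `ℓ + 1`) is excluded by the surjectivity of `ρ̄` (Čebotarev), so "functions modulo constants" (KO23) and the full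
function space `Cls O → 𝔽_p` have the same `𝔪^{an}`-eigenvectors; (R4) `N(ρ̄_{E,p}) = N_E` from "`E[p]` ramified at every
`q ∣ N`" and `p ≥ 5` (at additive `q ≠ p` the inertia image has order prime to `p`, or is `χ ⊗` unipotent, so Swan and tame
exponents reduce unchanged; at multiplicative `q` ramification keeps `q ∥ N(ρ̄)`); (R5) at SQUARE-FREE `N` the statement is
in Pollack–Weston's Thm. 6.2 setting (Helm's multiplicity one); at general `N` it rests on Kim–Ota's Thm. 5.5 whose printed
proof is by reference to Chida–Hsieh (ordinary deformation condition) with Remark 5.6 for the crystalline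
(non-ordinary, `2 ≤ k ≤ p − 1`) replacement — flag `KO23-5.5-proof-by-reference`; the consumer's `p` is supersingular.
Flags: `mult-one-socle-vs-cosocle`, `anemic-vs-full`, `KO23-5.5-proof-by-reference`, `mulVec-convention` (eigenvectors of
`T(n)` via `Matrix.mulVec` = Gross's `t_n`; transposing by the weights does not change dimensions).  CONSEQUENCE-READING of
print (socle/anemic form of a freeness theorem): neither the freeness of `S_𝔪` nor Gorenstein-ness is asserted; nothing
stronger than print + (R1)–(R4) is claimed; no `_holds` expected (XL: Taylor–Wiles / Helm).  No case of BSD and no crux is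
proved or asserted by this file.

## References
* [PollackWeston2011] R. Pollack, T. Weston, *On anticyclotomic μ-invariants of modular forms*, Compos. Math. 147 (2011)
  1353–1381, §2.1, §4.3, Thm. 6.2.
* [KimOta2023] C.-H. Kim, K. Ota, *On the quantitative variation of congruence ideals and integral periods of modular
  forms*, Res. Math. Sci. 10 (2023) (arXiv:1905.02926), Assumption 1.4, §5.1, Assumption 5.3 (CR⁺), Thm. 5.5, Rem. 5.6.
* [ChidaHsieh2018Crelle] M. Chida, M.-L. Hsieh, *Special values of anticyclotomic L-functions for modular forms*, J. reine
  angew. Math. 741 (2018) (the freeness behind KO23 Thm. 5.5).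
* [BertoliniDarmon2005] M. Bertolini, H. Darmon, *Iwasawa's Main Conjecture for elliptic curves over anticyclotomic
  ℤ_p-extensions*, Ann. of Math. 162 (2005), p. 18 (admissible primes), Thm. 5.15, p. 56.
* [CastellaEtAl2025] F. Castella, C.-Y. Hsu, D. Kundu, Y.-S. Lee, Z. Liu, arXiv:2308.10474v2, §7.2 Remark 7.3, Thm. 7.4.
-/

noncomputable section

open scoped Classical
open NumberField IsDedekindDomain Field
open Literature.NumberTheory.EllipticCurves Literature.NumberTheory.EllipticCurves.Rank1Residual
  Literature.NumberTheory.EllipticCurves.CastellaHsuKunduLeeLiu2025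
  Literature.NumberTheory.GaloisRepresentations Literature.NumberTheory.Automorphic

namespace Literature.NumberTheory.EllipticCurves.DefiniteMultiplicityOne

/-- **Multiplicity one modulo `p` on the definite side, eigenvector form (Pollack–Weston 2011 Thm. 6.2 at square-free `N` /
Kim–Ota 2023 Thm. 5.5 under (CR⁺), read through (R1)–(R5) of the module docstring).**  Printed (KO23 Thm. 5.5): "Under
Assumption (CR⁺), `S^{N⁻}_k(N, 𝒪)_𝔪` is a free `𝕋^{N⁻}(N)_𝔪`-module of rank one"; (PW11 Thm. 6.2): "If `(ρ̄_f, rN₂)` satisfies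
hypothesis (CR), then `X̂_r(N₁, N₂)` is free of rank one over the Hecke algebra `𝕋̂_0(N₁/r, rN₂)`"; (BD05 p. 56): "By
multiplicity one, this function is equal modulo `pⁿ` to the eigenform `f` … (up to multiplication by an element of
`(ℤ/pⁿℤ)^×`)".  TYPED (`n = 1`, `k = 2`, `(N⁺, N⁻) = (N_E, m)`): for `W/ℚ` globally minimal of conductor `N`, `p ≥ 5` of good
reduction, `ρ̄_{E,p}` surjective, `K` imaginary quadratic with every `ℓ ∣ N` split, `E[p]` ramified at every `q ∣ N`, every
`m ∈ 𝒩₁^def` (`defProducts N K (a_ℓ(E)) p 1`) and every definite set-up `S` of type `(N, m)`: two mod-`p` common eigenvectors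
`φ₁, φ₂ : Cls(O) → 𝔽_p` of the Brandt matrices `T_ℓ` (`ℓ ∤ Nm` prime) for the eigenvalues `a_ℓ(E)` with `φ₁ ≠ 0` satisfy
`φ₂ = c • φ₁` for some `c ∈ 𝔽_p`.  The ONE delta to the LEAD's typing target `SpecMult1`: the hypothesis
`W.HasGoodReductionAtPrime p` (print's `p ∤ N`) is added.  A NAMED FACT; CONSEQUENCE-READING of print (socle / anemic form),
flags `mult-one-socle-vs-cosocle`, `anemic-vs-full`, `KO23-5.5-proof-by-reference`, `mulVec-convention`; no `_holds` expected.
[cite: KimOta2023, Assumption 1.4, §5.1, Assumption 5.3 and Thm. 5.5 with Remark 5.6 (arXiv:1905.02926 §5.3)]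
[cite: PollackWeston2011, §2.1 and Thm. 6.2] [cite: BertoliniDarmon2005, Thm. 5.15 (2) and p. 56 ("By multiplicity one …")]
[cite: CastellaEtAl2025, §7.2 Remark 7.3 and Thm. 7.4 (arXiv:2308.10474v2 p0030)] -/
def kimOta2023_thm55_brandtEigenvector_modP_unique : Prop :=
  ∀ (N : ℕ) [NeZero N] (W : WeierstrassCurve ℚ) [W.IsElliptic] [W.IsGloballyMinimal] (K : Type) [Field K] [NumberField K]
    (p : ℕ) [Fact p.Prime],
    (N : ℤ) = W.conductorNorm ℤ → 5 ≤ p → W.HasGoodReductionAtPrime p → Surj W p → IsImaginaryQuadratic K →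
    (∀ ℓ : ℕ, ℓ.Prime → ℓ ∣ N → ((Ideal.span {(ℓ : ℤ)}).primesOver (𝓞 K)).ncard = 2) →
    (∀ q : ℕ, q.Prime → q ∣ N →
      ∃ v : HeightOneSpectrum (𝓞 ℚ), ((q : ℕ) : 𝓞 ℚ) ∈ v.asIdeal ∧
        ∃ 𝔓 ∈ v.primesAbove, ∃ σ ∈ 𝔓.inertia (absoluteGaloisGroup ℚ),
          ∃ P : W.geomTorsion (p : ℤ), σ • P ≠ P) →
    ∀ m ∈ defProducts N K (fun ℓ ↦ W.frobeniusTrace ℓ) p 1, ∀ (S : Brandt.XiSetup N m)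
      (φ₁ φ₂ : Brandt.ClassSet S.O → ZMod p),
      (letI : Fintype (Brandt.ClassSet S.O) := Fintype.ofFinite _
       φ₁ ∈ Brandt.eigenSpace (ZMod p) (N * m) (Brandt.matrix S.O) (fun ℓ ↦ W.frobeniusTrace ℓ)) →
      (letI : Fintype (Brandt.ClassSet S.O) := Fintype.ofFinite _
       φ₂ ∈ Brandt.eigenSpace (ZMod p) (N * m) (Brandt.matrix S.O) (fun ℓ ↦ W.frobeniusTrace ℓ)) →
      φ₁ ≠ 0 → ∃ c : ZMod p, φ₂ = c • φ₁

/-- Unfolding lemma (definitional). [cite: KimOta2023, Thm. 5.5] -/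
theorem kimOta2023_thm55_brandtEigenvector_modP_unique_iff :
    kimOta2023_thm55_brandtEigenvector_modP_unique ↔
    ∀ (N : ℕ) [NeZero N] (W : WeierstrassCurve ℚ) [W.IsElliptic] [W.IsGloballyMinimal] (K : Type) [Field K] [NumberField K]
      (p : ℕ) [Fact p.Prime],
      (N : ℤ) = W.conductorNorm ℤ → 5 ≤ p → W.HasGoodReductionAtPrime p → Surj W p → IsImaginaryQuadratic K →
      (∀ ℓ : ℕ, ℓ.Prime → ℓ ∣ N → ((Ideal.span {(ℓ : ℤ)}).primesOver (𝓞 K)).ncard = 2) →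
      (∀ q : ℕ, q.Prime → q ∣ N →
        ∃ v : HeightOneSpectrum (𝓞 ℚ), ((q : ℕ) : 𝓞 ℚ) ∈ v.asIdeal ∧
          ∃ 𝔓 ∈ v.primesAbove, ∃ σ ∈ 𝔓.inertia (absoluteGaloisGroup ℚ),
            ∃ P : W.geomTorsion (p : ℤ), σ • P ≠ P) →
      ∀ m ∈ defProducts N K (fun ℓ ↦ W.frobeniusTrace ℓ) p 1, ∀ (S : Brandt.XiSetup N m)
        (φ₁ φ₂ : Brandt.ClassSet S.O → ZMod p),
        (letI : Fintype (Brandt.ClassSet S.O) := Fintype.ofFinite _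
         φ₁ ∈ Brandt.eigenSpace (ZMod p) (N * m) (Brandt.matrix S.O) (fun ℓ ↦ W.frobeniusTrace ℓ)) →
        (letI : Fintype (Brandt.ClassSet S.O) := Fintype.ofFinite _
         φ₂ ∈ Brandt.eigenSpace (ZMod p) (N * m) (Brandt.matrix S.O) (fun ℓ ↦ W.frobeniusTrace ℓ)) →
        φ₁ ≠ 0 → ∃ c : ZMod p, φ₂ = c • φ₁ :=
  Iff.rfl

end Literature.NumberTheory.EllipticCurves.DefiniteMultiplicityOne

end
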